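import Mathlib
import Summits.HodgeConjecture.FermatCycles.HodgeFermatDecodingC

/-!
# The DECODING THEOREM in ring form over `ZMod n`, every `n ≥ 11`, `n ≠ 13`, `3 ∤ n` — part 1: ring-form core lemmas, `Parity` (`HodgeFermat/DecodingRing.lean`; HF-G32b)

Tree copy (part 1 of 2) of the module `HodgeFermat/DecodingRing.lean` of the sibling cell's standalone package
`run/shared/lean/pub/pub-hodgefermat/lean/HodgeFermat/` (651 lines, sha256 `e7bd7f2b6b4f0457…`), source lines 30–328 (§1 the ring form of the point-evaluation lemmas `core33`/`core31`/`coreZZ`/`stepUU`/`coreUU`, §2 the predicate `Parity` and its permutation invariance).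
Filed by cell `pub-hfermat`, seat prover-1 gen-2, on the COORDINATOR KEEPER RULING of 2026-08-25 (gem sweep H1: take the
off-gate kernel theorem `thmFstar` through the gate) — here its second namesake, `HodgeFermat/ThmFstarNFinal.lean:29`,
THEOREM F*(3N) at every admissible squarefree level (the first, `DecodingFinal.thmFstar` = THEOREM F* at the prime levels,
landed on 2026-08-25 as `HodgeFermatThmFstar.lean`, seat prover-1 gen-0); this file is one link of the import closure of
`ThmFstarNFinal.thmFstar` on top of that landed chain.  The source module's declarations are VERBATIM those of the cell record
`check/ThmFstarN_standalone.lean` (21 bodies, 438 871 B, sha256 ced731ec52c92191…, hub `lean check` rc 0, 222.2 s, `--axioms …ThmFstarN.thmFstarN` = [propext, Classical.choice, Quot.sound]; pub-hodgefermat `CERT.md` l.987, GATE HF-G33).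
Deviations from the source module, exhaustively: the `import` lines (tree modules `Summits.HodgeConjecture.FermatCycles.
HodgeFermat*` instead of `HodgeFermat.*`); this module docstring; one-line docstrings added (gate lint) to `mul_ne`, `core33`, `core31`, `coreZZ`, `stepUU`, `coreUU`, `muFun_swap`, `muFun_rot`, `nuFun_swap`, `nuFun_rot`, `parity_symm`, `parity_swap_left`, `parity_rot_left`, `parity_swap_right`, `parity_rot_right`; the file ends at source l.328 (`end Parity`) with an `end` line (part 2 = `HodgeFermatDecodingRingB.lean`).
Every other line — in particular every declaration's statement and proof — is byte-identical to the source.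
HONEST FRAMING: explicit algebraic cycles for specific Hodge classes on Fermat/Delsarte varieties; residual open instances
listed; no claim on general Hodge.  (This file is arithmetic of CM types / of `(ℤ/N)ˣ`; it claims nothing about cycles.)

The source module's docstring (DecodingRing.lean l.1–27), verbatim:

Copyright: pub-hodgefermat, generation 32 (HF-G32b).  KR-free.
## DecodingRing — the DECODING THEOREM of HF-G32 over `ZMod n` for EVERY `n ≥ 11`, `n ≠ 13`, `3 ∤ n`
  (ring form of `Decoding`; the composite-level half of THEOREM F* of `tables/DPRIME-THEOREM.md` §9, m = 3m₁).

THEOREM (decoding, ring form) `thmF_of_parity`: let `n ≥ 11`, `n ≠ 13`, `3 ∤ n`, and let `T = (a, b, c)`, `T′ = (a′, b′, c′)` be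
zero-sum triples mod `3n` with all entries prime to `n`, DISJOINT mod `3n`.  Then PARITY(3n) fails for (T, T′), where
  PARITY(3n) (`Parity n T T′`):  E = μ_T − μ_T′ is EVEN on `ZMod n`,  D = ν_T − ν_T′ is ODD on `ZMod n`,  Σ_T χ₃ = Σ_T′ χ₃
(`μ`, `ν` = `MuEven.muFun`, `NuOdd.nuFun`, now read on `ZMod n` for arbitrary `n`).  NO hypothesis `H0`, no CM types: a closed
combinatorial theorem.  At a PRIME n = p, PARITY(3p) holds for same-type pairs by HF-G31c/e + `NuOddSharp` (from `H0`), and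
`thmFstar'` re-derives `Decoding.thmFstar` from the ring theorem (consistency check).  At COMPOSITE n = m₁ the theorem is the
decoding half of THEOREM F*(3m₁): what remains for generation 33 is PARITY(3m₁) for same-type pairs, i.e. LEMMA E with its Bad set
at composite level (HANDOFF §5 1(a)).
PROOF: the point-evaluation lemmas of `Decoding` §§3–6 use the field structure only through cancellations `k·Y = 0 ⟹ False`
with `k` a numeral and `Y` an ENTRY; in a commutative ring it suffices that the entry is a UNIT and the numeral non-zero (`mul_ne`),
plus — in the (Z1, Z1) lemma only — that `2` and `3` are units (three cancellations of `2`, `3` against non-entries).  §1 copies the five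
lemmas in this form (proof scripts otherwise verbatim: folded indicators, `linear_combination`, `omega`); §2 the predicate `Parity`
and its invariance under permutations of the entries (replacing the type-preserving permutations `st_swap` / `st_rot`); §3 the level
`3n`: entries prime to `n` are units of `ZMod n` (`ZMod.isUnit_iff_coprime`), `2, 3` are units for `gcd(n, 6) = 1`, the numerals
`2, 3, 4, 5, 7, 8, 9, 13, 15` are non-zero for `n ≥ 11`, `n ≠ 13`, `3 ∤ n`, and disjointness mod `3n` within a class mod 3 is
distinctness in `ZMod n` (CRT, `gcd(3, n) = 1`); §4 the four pattern cases; §5 the assembly; §6 the prime-level corollary.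
`n = 13` (level 39) is a genuine exception ((U, U): `13·u = 0`); for EVEN `n` the hypotheses are contradictory (entries prime to `n` are odd,
`two_not_dvd`), and for odd `n` (`thmF_of_parity_odd`) the unit `2` is used only in (Z1, Z1).
Record `check/DecodingRing_standalone.lean` (11 bodies); controls `code/gen32/lean-controls-g32/ControlND_*`, `ControlNE_*`;
cross-read `code/gen32/parity_scan_composite.py`.  No `sorry`; no `decide`; axioms [propext, Classical.choice, Quot.sound].
NOT imported by the root `HodgeFermat.lean`.
-/

set_option autoImplicit false

namespace HodgeFermat.KRFree.DecodingRing

open HodgeFermat.KRFree.LemmaN HodgeFermat.KRFree.LemmaEMu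
open HodgeFermat.KRFree.MuEven (muEntry muFun mu_even)
open HodgeFermat.KRFree.NuOdd (nuEntry nuFun)
open HodgeFermat.KRFree.NuOddSharp (nu_odd' nu_sum_eq')
open HodgeFermat.KRFree.ChiThree (chi3 chi3_ne_zero)
open HodgeFermat.KRFree.Decoding (ind ind_pos ind_neg ind_bd ind_True ind_False mZ dZ mU nU mU_swap mU_rot nU_swap nU_rot
  muFun_U muFun_Z1 muFun_Z3 nuFun_U nuFun_Z1 nuFun_Z3 chi3_congr mod_eq_of_chi3_eq chi3_neg sum3_U sum3_Z three_dvd p_dvd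
  third_ne_of_nmod zsum_U zsum_Z1 zsum_Z3)

section Core

/-! ## 1. The ring form of the point-evaluation lemmas of `Decoding` §§3–6
Verbatim copies of `Decoding.core33` / `core31` / `coreZZ` / `stepUU` / `coreUU` with `[Field F]` replaced by a nontrivial
commutative ring, the ENTRIES units (`IsUnit`), the numerals `≠ 0` — except `2, 3` in `coreZZ`, which must be units (three
cancellations `3·(Y′ + Y) = 0`, `2·(U′ − U) = 0`, `3·(Y′ − 2Y) = 0`); `mul_ne` now cancels the unit ENTRY. -/

variable {F : Type*} [CommRing F] [Nontrivial F] [DecidableEq F]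

omit [Nontrivial F] [DecidableEq F] in
/-- in a commutative ring: `k ≠ 0`, `Y` a unit, `k·Y = 0` is absurd -/
lemma mul_ne {k Y : F} (hk : k ≠ 0) (hY : IsUnit Y) (h : k * Y = 0) : False := hk ((IsUnit.mul_left_eq_zero hY).mp h)

/-! ### (Z3, Z3): `E = μ_T − μ_T′` even is impossible (evaluate at `x = I`) -/

/-- (Z3, Z3) in ring form: `E = μ_T − μ_T′` even is impossible (evaluate at `x = I`) -/
theorem core33 (h2 : (2 : F) ≠ 0) {I J K I' J' K' : F} (hs : I + J + K = 0)
    (hI : IsUnit I) (hJ : IsUnit J) (hK : IsUnit K) (hd1 : I' ≠ I) (hd2 : J' ≠ I) (hd3 : K' ≠ I)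
    (hE : ∀ x, 2 * nU I J K (-x) - 2 * nU I' J' K' (-x) = 2 * nU I J K x - 2 * nU I' J' K' x) : False := by
  have f1 : I ≠ -I := fun h => mul_ne h2 hI (by linear_combination h)
  have f2 : J ≠ -I := fun h => hK.ne_zero (by linear_combination hs - h)
  have f3 : K ≠ -I := fun h => hJ.ne_zero (by linear_combination hs - h)
  have e := hE I
  simp only [nU, ind_True, ind_neg f1, ind_neg f2, ind_neg f3, ind_neg hd1, ind_neg hd2, ind_neg hd3] at e
  have := ind_bd (J = I); have := ind_bd (K = I)
  have := ind_bd (I' = -I); have := ind_bd (J' = -I); have := ind_bd (K' = -I)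
  omega

/-! ### (Z3, Z1): `D` odd forces `V = U` (at `x = U`), then `E` even fails at `x = Y` -/

/-- (Z3, Z1) in ring form: `D` odd forces `V = U` (at `x = U`), then `E` even fails at `x = Y` -/
theorem core31 (h2 : (2 : F) ≠ 0) (h3 : (3 : F) ≠ 0) (h5 : (5 : F) ≠ 0) (h9 : (9 : F) ≠ 0)
    {I J K Y U V : F} (hs' : 3 * Y + U + V = 0)
    (hY : IsUnit Y) (hU : IsUnit U) (hd1 : I ≠ Y) (hd2 : J ≠ Y) (hd3 : K ≠ Y)
    (hE : ∀ x, 2 * nU I J K (-x) - mZ Y U V (-x) = 2 * nU I J K x - mZ Y U V x)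
    (hD : ∀ x, -(ind (U = -x) - ind (V = -x)) = ind (U = x) - ind (V = x)) : False := by
  have f1 : U ≠ -U := fun h => mul_ne h2 hU (by linear_combination h)
  have f2 : V ≠ -U := fun h => mul_ne h3 hY (by linear_combination hs' - h)
  have dU := hD U
  simp only [ind_True, ind_neg f1, ind_neg f2] at dU
  by_cases hUV : U = V
  swap
  · have hVU : V ≠ U := fun h => hUV h.symm
    rw [ind_neg hVU] at dU; omega
  subst hUV
  have f3 : Y ≠ -Y := fun h => mul_ne h2 hY (by linear_combination h)
  have f4 : U ≠ Y := fun h => mul_ne h5 hY (by linear_combination hs' - 2 * h)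
  have f5 : U ≠ 3 * Y := fun h => mul_ne h9 hY (by linear_combination hs' - 2 * h)
  have f6 : U ≠ -Y := fun h => hY.ne_zero (by linear_combination hs' - 2 * h)
  have f7 : U ≠ -(3 * Y) := fun h => mul_ne h3 hY (by linear_combination -hs' + 2 * h)
  have e := hE Y
  simp only [nU, mZ, mul_neg, ind_True, ind_neg hd1, ind_neg hd2, ind_neg hd3, ind_neg f3, ind_neg f4,
    ind_neg f5, ind_neg f6, ind_neg f7] at e
  have := ind_bd (I = -Y); have := ind_bd (J = -Y); have := ind_bd (K = -Y)
  omega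

/-! ### (Z1, Z1) -/

/-- (Z1, Z1) in ring form: the dichotomy `T′ ≡ −T` or a shared entry -/
theorem coreZZ (h2 : IsUnit (2 : F)) (h3 : IsUnit (3 : F)) (h4 : (4 : F) ≠ 0) (h5 : (5 : F) ≠ 0) (h7 : (7 : F) ≠ 0)
    (h9 : (9 : F) ≠ 0) (h15 : (15 : F) ≠ 0)
    {Y U V Y' U' V' : F} (hs : 3 * Y + U + V = 0) (hs' : 3 * Y' + U' + V' = 0)
    (hY : IsUnit Y) (hU : IsUnit U) (hV : IsUnit V) (hY' : IsUnit Y') (hU' : IsUnit U') (hV' : IsUnit V')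
    (hdU : U' ≠ U) (hdV : V' ≠ V)
    (hE : ∀ x, mZ Y U V (-x) - mZ Y' U' V' (-x) = mZ Y U V x - mZ Y' U' V' x)
    (hD : ∀ x, dZ U V U' V' (-x) = -dZ U V U' V' x) : False := by
  -- Step 1: `D` odd at `x = U`
  have f1 : U ≠ -U := fun h => mul_ne h2.ne_zero hU (by linear_combination h)
  have f2 : V ≠ -U := fun h => mul_ne h3.ne_zero hY (by linear_combination hs - h)
  have dU := hD U
  simp only [dZ, ind_True, ind_neg f1, ind_neg f2, ind_neg hdU] at dU
  by_cases hA : U' = -U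
  · ----------------------------------------------------------------- case (α): T′ ≡ −T
    subst hA
    have f3 : U ≠ -V := fun h => mul_ne h3.ne_zero hY (by linear_combination hs - h)
    have f4 : V ≠ -V := fun h => mul_ne h2.ne_zero hV (by linear_combination h)
    have dV := hD V
    simp only [dZ, neg_neg, neg_eq_iff_eq_neg, ind_True, ind_neg f3, ind_neg f4, ind_neg hdV] at dV
    by_cases hB : V' = -V
    swap
    · rw [ind_neg hB] at dV; omega
    subst hB
    have hC : Y' = -Y := by
      have h : (3 : F) * (Y' + Y) = 0 := by linear_combination hs' + hs
      linear_combination (IsUnit.mul_right_eq_zero h3).mp h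
    subst hC
    -- `E` even at `x = Y`
    have f5 : Y ≠ -Y := fun h => mul_ne h2.ne_zero hY (by linear_combination h)
    have f6 : U ≠ -(3 * Y) := fun h => hV.ne_zero (by linear_combination hs - h)
    have f7 : V ≠ -(3 * Y) := fun h => hU.ne_zero (by linear_combination hs - h)
    have e := hE Y
    simp only [mZ, mul_neg, neg_neg, neg_eq_iff_eq_neg, ind_True, ind_neg f5, ind_neg f6, ind_neg f7] at e
    have g1 : ¬ (U = -Y ∧ V = -Y) := fun hh => hY.ne_zero (by linear_combination hs - hh.1 - hh.2)
    by_cases hU3 : U = 3 * Y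
    · have hV6 : V = -(6 * Y) := by linear_combination hs - hU3
      have f8 : U ≠ -Y := fun h => mul_ne h4 hY (by linear_combination h - hU3)
      have f9 : V ≠ -Y := fun h => mul_ne h5 hY (by linear_combination hV6 - h)
      have f10 : U ≠ Y := fun h => mul_ne h2.ne_zero hY (by linear_combination h - hU3)
      have f11 : V ≠ 3 * Y := fun h => mul_ne h9 hY (by linear_combination hV6 - h)
      have f12 : V ≠ Y := fun h => mul_ne h7 hY (by linear_combination hV6 - h)
      rw [ind_pos hU3, ind_neg f8, ind_neg f9, ind_neg f10, ind_neg f11, ind_neg f12] at e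
      omega
    · by_cases hV3 : V = 3 * Y
      · have hU6 : U = -(6 * Y) := by linear_combination hs - hV3
        have f8 : V ≠ -Y := fun h => mul_ne h4 hY (by linear_combination h - hV3)
        have f9 : U ≠ -Y := fun h => mul_ne h5 hY (by linear_combination hU6 - h)
        have f10 : V ≠ Y := fun h => mul_ne h2.ne_zero hY (by linear_combination h - hV3)
        have f12 : U ≠ Y := fun h => mul_ne h7 hY (by linear_combination hU6 - h)
        rw [ind_pos hV3, ind_neg hU3, ind_neg f8, ind_neg f9, ind_neg f10, ind_neg f12] at e
        omega
      · rw [ind_neg hU3, ind_neg hV3] at e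
        by_cases hUm : U = -Y
        · by_cases hVm : V = -Y
          · exact g1 ⟨hUm, hVm⟩
          · rw [ind_pos hUm, ind_neg hVm] at e
            have := ind_bd (U = Y); have := ind_bd (V = Y)
            omega
        · rw [ind_neg hUm] at e
          have := ind_bd (U = Y); have := ind_bd (V = Y); have := ind_bd (V = -Y)
          omega
  · ----------------------------------------------------------------- case (β): U = V and U′ = V′
    rw [ind_neg hA] at dU
    by_cases hB : U = V
    swap
    · have hVU : V ≠ U := fun h => hB h.symm
      rw [ind_neg hVU] at dU
      have := ind_bd (V' = U); have := ind_bd (V' = -U)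
      omega
    subst hB
    have f3 : U' ≠ -U' := fun h => mul_ne h2.ne_zero hU' (by linear_combination h)
    have f4 : V' ≠ -U' := fun h => mul_ne h3.ne_zero hY' (by linear_combination hs' - h)
    have dU' := hD U'
    simp only [dZ, sub_self, ind_True, ind_neg f3, ind_neg f4] at dU'
    by_cases hC : U' = V'
    swap
    · have hVU' : V' ≠ U' := fun h => hC h.symm
      rw [ind_neg hVU'] at dU'; omega
    subst hC
    -- now `hs : 3Y + U + U = 0`, `hs' : 3Y' + U' + U' = 0`, `hdU : U' ≠ U`, `hA : U' ≠ -U`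
    have fYY : Y' ≠ Y := by
      intro h
      have h2c : (2 : F) * (U' - U) = 0 := by linear_combination hs' - hs - 3 * h
      exact hdU (by linear_combination (IsUnit.mul_right_eq_zero h2).mp h2c)
    -- `E` even at `x = Y`
    have f5 : Y ≠ -Y := fun h => mul_ne h2.ne_zero hY (by linear_combination h)
    have f6 : U ≠ -Y := fun h => hY.ne_zero (by linear_combination hs - 2 * h)
    have f7 : U ≠ -(3 * Y) := fun h => mul_ne h3.ne_zero hY (by linear_combination -hs + 2 * h)
    have f8 : U ≠ Y := fun h => mul_ne h5 hY (by linear_combination hs - 2 * h)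
    have f9 : U ≠ 3 * Y := fun h => mul_ne h9 hY (by linear_combination hs - 2 * h)
    have e := hE Y
    simp only [mZ, mul_neg, ind_True, ind_neg f5, ind_neg f6, ind_neg f7, ind_neg f8, ind_neg f9,
      ind_neg fYY] at e
    -- `E` even at `x = Y'`
    have f5' : Y' ≠ -Y' := fun h => mul_ne h2.ne_zero hY' (by linear_combination h)
    have f6' : U' ≠ -Y' := fun h => hY'.ne_zero (by linear_combination hs' - 2 * h)
    have f7' : U' ≠ -(3 * Y') := fun h => mul_ne h3.ne_zero hY' (by linear_combination -hs' + 2 * h)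
    have f8' : U' ≠ Y' := fun h => mul_ne h5 hY' (by linear_combination hs' - 2 * h)
    have f9' : U' ≠ 3 * Y' := fun h => mul_ne h9 hY' (by linear_combination hs' - 2 * h)
    have e' := hE Y'
    simp only [mZ, mul_neg, ind_True, ind_neg f5', ind_neg f6', ind_neg f7', ind_neg f8', ind_neg f9',
      ind_neg (Ne.symm fYY)] at e'
    by_cases hB1 : U' = -(3 * Y)
    · -- then `Y' = 2Y`
      have hY2 : Y' = 2 * Y := by
        have h3c : (3 : F) * (Y' - 2 * Y) = 0 := by linear_combination hs' - 2 * hB1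
        linear_combination (IsUnit.mul_right_eq_zero h3).mp h3c
      have j1 : Y ≠ -Y' := fun h => mul_ne h3.ne_zero hY (by linear_combination h - hY2)
      have j2 : U ≠ -Y' := fun h => hY.ne_zero (by linear_combination -hs + 2 * h - 2 * hY2)
      have j3 : U ≠ -(3 * Y') := fun h => mul_ne h9 hY (by linear_combination -hs + 2 * h - 6 * hY2)
      have j4 : U ≠ Y' := fun h => mul_ne h7 hY (by linear_combination hs - 2 * h - 2 * hY2)
      have j5 : U ≠ 3 * Y' := fun h => mul_ne h15 hY (by linear_combination hs - 2 * h - 6 * hY2)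
      rw [ind_neg j1, ind_neg j2, ind_neg j3, ind_neg j4, ind_neg j5] at e'
      omega
    · by_cases hB2 : U' = Y
      · have hY'2 : 3 * Y' = -(2 * Y) := by linear_combination hs' - 2 * hB2
        have j1 : Y ≠ -Y' := fun h => hY.ne_zero (by linear_combination 3 * h - hY'2)
        have j3 : U ≠ -(3 * Y') := fun h => mul_ne h7 hY (by linear_combination hs - 2 * h + 2 * hY'2)
        have j4 : U ≠ Y' := fun h => mul_ne h5 hY (by linear_combination 3 * hs - 6 * h - 2 * hY'2)
        have j5 : U ≠ 3 * Y' := fun h => hY.ne_zero (by linear_combination -1 * hs + 2 * h + 2 * hY'2)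
        rw [ind_neg j1, ind_neg j3, ind_neg j4, ind_neg j5] at e'
        have := ind_bd (U = -Y')
        omega
      · rw [ind_neg hB1, ind_neg hB2] at e
        have := ind_bd (Y' = -Y); have := ind_bd (U' = -Y); have := ind_bd (U' = 3 * Y)
        omega

/-! ### (U, U): per base point `3U ∈ T`, hence a ×3-cycle `U, 3U, 9U` and `13U = 0` -/

/-- (U, U) in ring form, one step: from the base point `U`, `3U ∈ T` -/
lemma stepUU (h2 : (2 : F) ≠ 0) (h4 : (4 : F) ≠ 0) {U V W U' V' W' : F} (hs : U + V + W = 0)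
    (hU : IsUnit U) (hV : IsUnit V) (hW : IsUnit W) (hd1 : U' ≠ U) (hd2 : V' ≠ U) (hd3 : W' ≠ U)
    (eU : mU U V W (-U) - mU U' V' W' (-U) = mU U V W U - mU U' V' W' U)
    (dU : nU U V W (-U) - nU U' V' W' (-U) = -(nU U V W U - nU U' V' W' U))
    (d3 : nU U V W (-(3 * U)) - nU U' V' W' (-(3 * U)) = -(nU U V W (3 * U) - nU U' V' W' (3 * U))) :
    V = 3 * U ∨ W = 3 * U := by
  have f1 : U ≠ -U := fun h => mul_ne h2 hU (by linear_combination h)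
  have f2 : V ≠ -U := fun h => hW.ne_zero (by linear_combination hs - h)
  have f3 : W ≠ -U := fun h => hV.ne_zero (by linear_combination hs - h)
  have f4 : U ≠ 3 * U := fun h => mul_ne h2 hU (by linear_combination -h)
  have f5 : U ≠ -(3 * U) := fun h => mul_ne h4 hU (by linear_combination h)
  simp only [mU, nU, mul_neg, ind_True, ind_neg f1, ind_neg f2, ind_neg f3, ind_neg f4, ind_neg f5,
    ind_neg hd1, ind_neg hd2, ind_neg hd3] at eU dU d3
  by_cases hV3 : V = 3 * U
  · exact Or.inl hV3
  by_cases hW3 : W = 3 * U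
  · exact Or.inr hW3
  exfalso
  rw [ind_neg hV3, ind_neg hW3] at eU d3
  have := ind_bd (V = U); have := ind_bd (W = U)
  have := ind_bd (V = -(3 * U)); have := ind_bd (W = -(3 * U))
  have := ind_bd (U' = 3 * U); have := ind_bd (V' = 3 * U); have := ind_bd (W' = 3 * U)
  have := ind_bd (U' = -(3 * U)); have := ind_bd (V' = -(3 * U)); have := ind_bd (W' = -(3 * U))
  have := ind_bd (U' = -U); have := ind_bd (V' = -U); have := ind_bd (W' = -U)
  omega

/-- (U, U) in ring form: a ×3-cycle `U, 3U, 9U` and `13U = 0` — impossible -/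
theorem coreUU (h2 : (2 : F) ≠ 0) (h4 : (4 : F) ≠ 0) (h8 : (8 : F) ≠ 0) (h13 : (13 : F) ≠ 0)
    {U V W U' V' W' : F} (hs : U + V + W = 0)
    (hU : IsUnit U) (hV : IsUnit V) (hW : IsUnit W)
    (d11 : U' ≠ U) (d21 : V' ≠ U) (d31 : W' ≠ U) (d12 : U' ≠ V) (d22 : V' ≠ V) (d32 : W' ≠ V)
    (d13 : U' ≠ W) (d23 : V' ≠ W) (d33 : W' ≠ W)
    (hE : ∀ x, mU U V W (-x) - mU U' V' W' (-x) = mU U V W x - mU U' V' W' x)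
    (hD : ∀ x, nU U V W (-x) - nU U' V' W' (-x) = -(nU U V W x - nU U' V' W' x)) : False := by
  have k1 := stepUU h2 h4 hs hU hV hW d11 d21 d31 (hE U) (hD U) (hD (3 * U))
  have hs2 : V + U + W = 0 := by linear_combination hs
  have hs3 : W + U + V = 0 := by linear_combination hs
  have k2 := stepUU h2 h4 hs2 hV hU hW d12 d22 d32
    (by rw [mU_swap U V W (-V), mU_swap U V W V]; exact hE V)
    (by rw [nU_swap U V W (-V), nU_swap U V W V]; exact hD V)
    (by rw [nU_swap U V W (-(3 * V)), nU_swap U V W (3 * V)]; exact hD (3 * V))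
  have k3 := stepUU h2 h4 hs3 hW hU hV d13 d23 d33
    (by rw [mU_rot U V W (-W), mU_rot U V W W]; exact hE W)
    (by rw [nU_rot U V W (-W), nU_rot U V W W]; exact hD W)
    (by rw [nU_rot U V W (-(3 * W)), nU_rot U V W (3 * W)]; exact hD (3 * W))
  rcases k1 with hV3 | hW3
  · rcases k2 with h | h
    · exact mul_ne h8 hU (by linear_combination -1 * h - 3 * hV3)
    · exact mul_ne h13 hU (by linear_combination hs - 4 * hV3 - h)
  · rcases k3 with h | h
    · exact mul_ne h8 hU (by linear_combination -1 * h - 3 * hW3)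
    · exact mul_ne h13 hU (by linear_combination hs - 4 * hW3 - h)

end Core

/-! ## 2. PARITY(3n) and its invariance under permutations of the entries -/

section Parity

variable {n : ℕ}

/-- PARITY(3n) for the ordered pair of triples `(T, T′)`: `E = μ_T − μ_T′` even and `D = ν_T − ν_T′` odd on `ZMod n`, `Σ_T χ₃ = Σ_T′ χ₃`. -/
def Parity (n : ℕ) (T T' : ℕ × ℕ × ℕ) : Prop :=
  (∀ x : ZMod n, muFun T (-x) - muFun T' (-x) = muFun T x - muFun T' x) ∧
  (∀ x : ZMod n, nuFun T (-x) - nuFun T' (-x) = -(nuFun T x - nuFun T' x)) ∧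
  chi3 T.1 + chi3 T.2.1 + chi3 T.2.2 = chi3 T'.1 + chi3 T'.2.1 + chi3 T'.2.2

/-- `μ` of a triple is invariant under swapping the first two entries -/
lemma muFun_swap (x y z : ℕ) (t : ZMod n) : muFun (y, x, z) t = muFun (x, y, z) t := by
  unfold muFun; dsimp only; ring

/-- `μ` of a triple is invariant under rotation of the entries -/
lemma muFun_rot (x y z : ℕ) (t : ZMod n) : muFun (z, x, y) t = muFun (x, y, z) t := by
  unfold muFun; dsimp only; ring

/-- `ν` of a triple is invariant under swapping the first two entries -/
lemma nuFun_swap (x y z : ℕ) (t : ZMod n) : nuFun (y, x, z) t = nuFun (x, y, z) t := by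
  unfold nuFun; dsimp only; ring

/-- `ν` of a triple is invariant under rotation of the entries -/
lemma nuFun_rot (x y z : ℕ) (t : ZMod n) : nuFun (z, x, y) t = nuFun (x, y, z) t := by
  unfold nuFun; dsimp only; ring

/-- `Parity` is symmetric in the two triples -/
lemma parity_symm {T T' : ℕ × ℕ × ℕ} (h : Parity n T T') : Parity n T' T :=
  ⟨fun x => by linear_combination (-1 : ℤ) * h.1 x, fun x => by linear_combination (-1 : ℤ) * h.2.1 x, h.2.2.symm⟩

/-- `Parity` is invariant under swapping the first two entries of the left triple -/
lemma parity_swap_left {a b c : ℕ} {T' : ℕ × ℕ × ℕ} (h : Parity n (a, b, c) T') : Parity n (b, a, c) T' := by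
  obtain ⟨hE, hD, hS⟩ := h
  refine ⟨fun x => ?_, fun x => ?_, ?_⟩
  · rw [muFun_swap a b c (-x), muFun_swap a b c x]; exact hE x
  · rw [nuFun_swap a b c (-x), nuFun_swap a b c x]; exact hD x
  · dsimp only at hS ⊢; linarith

/-- `Parity` is invariant under rotating the left triple -/
lemma parity_rot_left {a b c : ℕ} {T' : ℕ × ℕ × ℕ} (h : Parity n (a, b, c) T') : Parity n (c, a, b) T' := by
  obtain ⟨hE, hD, hS⟩ := h
  refine ⟨fun x => ?_, fun x => ?_, ?_⟩
  · rw [muFun_rot a b c (-x), muFun_rot a b c x]; exact hE x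
  · rw [nuFun_rot a b c (-x), nuFun_rot a b c x]; exact hD x
  · dsimp only at hS ⊢; linarith

/-- `Parity` is invariant under swapping the first two entries of the right triple -/
lemma parity_swap_right {a' b' c' : ℕ} {T : ℕ × ℕ × ℕ} (h : Parity n T (a', b', c')) : Parity n T (b', a', c') :=
  parity_symm (parity_swap_left (parity_symm h))

/-- `Parity` is invariant under rotating the right triple -/
lemma parity_rot_right {a' b' c' : ℕ} {T : ℕ × ℕ × ℕ} (h : Parity n T (a', b', c')) : Parity n T (c', a', b') :=
  parity_symm (parity_rot_left (parity_symm h))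

end Parity

end HodgeFermat.KRFree.DecodingRing
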